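import Summits.QuantumFields.QCD.Theorems.QuarksAsStableActionUnquenchedChessboardBoundStubAxisSwap
import Literature.MathematicalPhysics.QuantumLattice.WilsonDiracAP

/-!
# Four-axis iteration of the static slice bound
(stub `stub_staticIterate` of crux stmt-QuantumFields-9736, line `Sketch`)

Write `D[V] = ‖det D_W[V, m]‖` for the `r = 1` Wilson–Dirac operator of a `U(3)` lattice gauge field
`V` on the four-torus `(ℤ/L)⁴` (defining representation).  For an axis `μ` and a height `s : ℤ/L`
the *static slice field* `S^μ_s V` has the antiperiodic pattern on its `μ`-links (`-1` on the seam
`x_μ = -1`, `1` elsewhere) and the other links of `V` read on the slice `x_μ = s`: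
`(S^μ_s V)(x, j) = if j = μ then (if x_μ = -1 then -1 else 1) else V (x[μ ↦ s], j)`.
Throughout, these fields are written out as explicit lambdas (no definitions).

* `staticIterate_swap_static`: the exchange `σ = (0 μ)` of coordinates and directions,
  `(σV)(x, j) = V(x ∘ σ, σ j)`, satisfies `σ (S⁰_s (σ V)) = S^μ_s V`.
* `staticIterate_axisBound`: hence the time-direction static slice bound
  `D[V]^L ≤ ∏_s D[S⁰_s V]` for every field (hypothesis `hS` of the stub) holds in every
  direction, `D[V]^L ≤ ∏_s D[S^μ_s V]`, by the hypercubic covariance `det D_W[σV] = det D_W[V]`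
  (`AxisSwap.det_wilsonDirac_swap`, any `L`).
* `staticIterate_comp`: `S³_{s₃} (S²_{s₂} (S¹_{s₁} (S⁰_{s₀} V)))` is the all-seams trivial field
  `T(x, j) = if x_j = -1 then -1 else 1`, whatever `V` and the heights.
* `staticIterate_root`: if `x^L ≤ ∏_s y_s` with `0 ≤ y_s ≤ c` then `x ≤ c`.  Applied along the
  axes `3, 2, 1, 0` from the inside out (`staticIterate_level3/2/1`) this gives `D[V] ≤ D[T]`
  (`stub_staticIterate`).
-/

namespace Summit.QuantumFields.QCD.Cruxes.WilsonQuarkStability.FreeTangentLandauChessboard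

open Literature.MathematicalPhysics Literature.MathematicalPhysics.QuantumLattice
  Literature.MathematicalPhysics.QuantumFieldTheory
open Matrix Complex
open Summit.QuantumFields.QCD.Theorems.UnquenchedChessboardBoundLine

/-! ## Combinatorics of the static slice fields -/

/-- The exchange `σ = (0 μ)` of coordinates and directions carries the time-direction static slice
field of the exchanged field to the `μ`-direction static slice field: `σ (S⁰_s (σ V)) = S^μ_s V`
(static pattern with values `a` on the seam and `b` off it). -/
theorem staticIterate_swap_static {L : ℕ} {G : Type*} (a b : G) (μ : Fin 4) (s : ZMod L)
    (V : GaugeConfig 4 L G) :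
    (fun e : Edge 4 L =>
      (fun e₀ : Edge 4 L => if e₀.2 = 0 then (if e₀.1 0 = -1 then a else b)
        else (fun e' : Edge 4 L =>
            V (e'.1 ∘ ⇑(Equiv.swap (0 : Fin 4) μ), Equiv.swap (0 : Fin 4) μ e'.2))
          (Function.update e₀.1 0 s, e₀.2))
        (e.1 ∘ ⇑(Equiv.swap (0 : Fin 4) μ), Equiv.swap (0 : Fin 4) μ e.2)) =
      fun e : Edge 4 L => if e.2 = μ then (if e.1 μ = -1 then a else b)
        else V (Function.update e.1 μ s, e.2) := by
  ext ⟨x, j⟩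
  simp only [Function.comp_apply, Equiv.swap_apply_left, Equiv.swap_apply_self,
    Equiv.swap_apply_eq_iff, Function.update_comp_equiv, Equiv.symm_swap,
    AxisSwap.comp_swap_comp_swap]

/-- Four static slice operations, one per axis, land on the all-seams field with values `a` on the
seams `x_j = -1` and `b` off them, whatever the field `W` and the heights:
`S³_{s₃} (S²_{s₂} (S¹_{s₁} (S⁰_{s₀} W))) = T`. -/
theorem staticIterate_comp {L : ℕ} {G : Type*} (a b : G) (s₀ s₁ s₂ s₃ : ZMod L)
    (W : GaugeConfig 4 L G) :
    (fun e₃ : Edge 4 L => if e₃.2 = 3 then (if e₃.1 3 = -1 then a else b)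
      else (fun e₂ : Edge 4 L => if e₂.2 = 2 then (if e₂.1 2 = -1 then a else b)
        else (fun e₁ : Edge 4 L => if e₁.2 = 1 then (if e₁.1 1 = -1 then a else b)
          else (fun e₀ : Edge 4 L => if e₀.2 = 0 then (if e₀.1 0 = -1 then a else b)
            else W (Function.update e₀.1 0 s₀, e₀.2))
            (Function.update e₁.1 1 s₁, e₁.2))
          (Function.update e₂.1 2 s₂, e₂.2))
        (Function.update e₃.1 3 s₃, e₃.2)) =
      fun e : Edge 4 L => if e.1 e.2 = -1 then a else b := by
  ext ⟨x, j⟩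
  fin_cases j <;> simp [Function.update_of_ne]

/-! ## The geometric-mean root -/

/-- If `x ^ L ≤ ∏_{s : ℤ/L} y s` with `0 ≤ y s ≤ c` for all `s`, then `x ≤ c` (`L ≠ 0`). -/
theorem staticIterate_root {L : ℕ} [NeZero L] {x c : ℝ} {y : ZMod L → ℝ} (hc : 0 ≤ c)
    (hxy : x ^ L ≤ ∏ s, y s) (hy : ∀ s, 0 ≤ y s) (hyc : ∀ s, y s ≤ c) : x ≤ c := by
  refine le_of_pow_le_pow_left₀ (NeZero.ne L) hc (hxy.trans ?_)
  calc ∏ s, y s ≤ ∏ _s : ZMod L, c := Finset.prod_le_prod (fun s _ => hy s) fun s _ => hyc s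
    _ = c ^ L := by rw [Finset.prod_const, Finset.card_univ, ZMod.card]

/-! ## The static slice bound in every direction -/

/-- **The `μ`-direction static slice bound** `D[V]^L ≤ ∏_s D[S^μ_s V]`, from the time-direction
bound for every field (hypothesis `hS`) applied to the exchanged field `σV`, `σ = (0 μ)`, the
hypercubic covariance `det D_W[σV] = det D_W[V]` (twice) and `σ (S⁰_s (σ V)) = S^μ_s V`. -/
theorem staticIterate_axisBound {L : ℕ} [NeZero L]
    (hS : ∀ (V : GaugeConfig 4 L (Matrix.unitaryGroup (Fin 3) ℂ)) (m : ℝ), -1 < m →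
      ‖(wilsonDirac (unitaryFundamentalRep (Fin 3) ℂ) V m 1).det‖ ^ L ≤
        ∏ s : ZMod L, ‖(wilsonDirac (unitaryFundamentalRep (Fin 3) ℂ)
          (fun e : Edge 4 L => if e.2 = 0 then
              (if e.1 0 = -1 then (-1 : Matrix.unitaryGroup (Fin 3) ℂ) else 1)
            else V (Function.update e.1 0 s, e.2)) m 1).det‖)
    (μ : Fin 4) (V : GaugeConfig 4 L (Matrix.unitaryGroup (Fin 3) ℂ)) (m : ℝ) (hm : -1 < m) :
    ‖(wilsonDirac (unitaryFundamentalRep (Fin 3) ℂ) V m 1).det‖ ^ L ≤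
      ∏ s : ZMod L, ‖(wilsonDirac (unitaryFundamentalRep (Fin 3) ℂ)
        (fun e : Edge 4 L => if e.2 = μ then
            (if e.1 μ = -1 then (-1 : Matrix.unitaryGroup (Fin 3) ℂ) else 1)
          else V (Function.update e.1 μ s, e.2)) m 1).det‖ := by
  have hρ : ∀ g : Matrix.unitaryGroup (Fin 3) ℂ,
      unitaryFundamentalRep (Fin 3) ℂ g ∈ Matrix.unitaryGroup (Fin 3) ℂ :=
    unitaryFundamentalRep_mem_unitaryGroup
  have h1 := hS (fun e : Edge 4 L =>
    V (e.1 ∘ ⇑(Equiv.swap (0 : Fin 4) μ), Equiv.swap (0 : Fin 4) μ e.2)) m hm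
  have h2 : ‖(wilsonDirac (unitaryFundamentalRep (Fin 3) ℂ) V m 1).det‖ ^ L =
      ‖(wilsonDirac (unitaryFundamentalRep (Fin 3) ℂ) (fun e : Edge 4 L =>
        V (e.1 ∘ ⇑(Equiv.swap (0 : Fin 4) μ), Equiv.swap (0 : Fin 4) μ e.2)) m 1).det‖ ^ L :=
    congrArg (fun z : ℂ => ‖z‖ ^ L)
      (AxisSwap.det_wilsonDirac_swap (unitaryFundamentalRep (Fin 3) ℂ) hρ V μ m).symm
  refine (h2.trans_le h1).trans_eq (Finset.prod_congr rfl fun s _ => ?_)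
  exact (congrArg (fun z : ℂ => ‖z‖)
    (AxisSwap.det_wilsonDirac_swap (unitaryFundamentalRep (Fin 3) ℂ) hρ _ μ m)).symm.trans
      (congrArg (fun U : GaugeConfig 4 L (Matrix.unitaryGroup (Fin 3) ℂ) =>
          ‖(wilsonDirac (unitaryFundamentalRep (Fin 3) ℂ) U m 1).det‖)
        (staticIterate_swap_static (-1 : Matrix.unitaryGroup (Fin 3) ℂ) 1 μ s V))

/-! ## The descent along the axes `3, 2, 1, 0` -/

/-- Level 3: every field of the form `S²_{s₂} (S¹_{s₁} (S⁰_{s₀} W))` is dominated by the all-seams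
trivial field (axis-`3` bound, whose factors are all `D[T]` by `staticIterate_comp`). -/
theorem staticIterate_level3 {L : ℕ} [NeZero L]
    (hS : ∀ (V : GaugeConfig 4 L (Matrix.unitaryGroup (Fin 3) ℂ)) (m : ℝ), -1 < m →
      ‖(wilsonDirac (unitaryFundamentalRep (Fin 3) ℂ) V m 1).det‖ ^ L ≤
        ∏ s : ZMod L, ‖(wilsonDirac (unitaryFundamentalRep (Fin 3) ℂ)
          (fun e : Edge 4 L => if e.2 = 0 then
              (if e.1 0 = -1 then (-1 : Matrix.unitaryGroup (Fin 3) ℂ) else 1)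
            else V (Function.update e.1 0 s, e.2)) m 1).det‖)
    (m : ℝ) (hm : -1 < m) (W : GaugeConfig 4 L (Matrix.unitaryGroup (Fin 3) ℂ))
    (s₀ s₁ s₂ : ZMod L) :
    ‖(wilsonDirac (unitaryFundamentalRep (Fin 3) ℂ)
      (fun e₂ : Edge 4 L => if e₂.2 = 2 then
          (if e₂.1 2 = -1 then (-1 : Matrix.unitaryGroup (Fin 3) ℂ) else 1)
        else (fun e₁ : Edge 4 L => if e₁.2 = 1 then
            (if e₁.1 1 = -1 then (-1 : Matrix.unitaryGroup (Fin 3) ℂ) else 1)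
          else (fun e₀ : Edge 4 L => if e₀.2 = 0 then
              (if e₀.1 0 = -1 then (-1 : Matrix.unitaryGroup (Fin 3) ℂ) else 1)
            else W (Function.update e₀.1 0 s₀, e₀.2))
            (Function.update e₁.1 1 s₁, e₁.2))
          (Function.update e₂.1 2 s₂, e₂.2)) m 1).det‖ ≤
      ‖(wilsonDirac (unitaryFundamentalRep (Fin 3) ℂ)
        (fun e : Edge 4 L => if e.1 e.2 = -1 then (-1 : Matrix.unitaryGroup (Fin 3) ℂ) else 1)
        m 1).det‖ := by
  refine staticIterate_root (norm_nonneg _) (staticIterate_axisBound hS 3 _ m hm)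
    (fun _ => norm_nonneg _) fun s₃ => le_of_eq ?_
  exact congrArg (fun U : GaugeConfig 4 L (Matrix.unitaryGroup (Fin 3) ℂ) =>
      ‖(wilsonDirac (unitaryFundamentalRep (Fin 3) ℂ) U m 1).det‖)
    (staticIterate_comp (-1 : Matrix.unitaryGroup (Fin 3) ℂ) 1 s₀ s₁ s₂ s₃ W)

/-- Level 2: every field of the form `S¹_{s₁} (S⁰_{s₀} W)` is dominated by the all-seams trivial
field (axis-`2` bound and level 3). -/
theorem staticIterate_level2 {L : ℕ} [NeZero L]
    (hS : ∀ (V : GaugeConfig 4 L (Matrix.unitaryGroup (Fin 3) ℂ)) (m : ℝ), -1 < m →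
      ‖(wilsonDirac (unitaryFundamentalRep (Fin 3) ℂ) V m 1).det‖ ^ L ≤
        ∏ s : ZMod L, ‖(wilsonDirac (unitaryFundamentalRep (Fin 3) ℂ)
          (fun e : Edge 4 L => if e.2 = 0 then
              (if e.1 0 = -1 then (-1 : Matrix.unitaryGroup (Fin 3) ℂ) else 1)
            else V (Function.update e.1 0 s, e.2)) m 1).det‖)
    (m : ℝ) (hm : -1 < m) (W : GaugeConfig 4 L (Matrix.unitaryGroup (Fin 3) ℂ))
    (s₀ s₁ : ZMod L) :
    ‖(wilsonDirac (unitaryFundamentalRep (Fin 3) ℂ)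
      (fun e₁ : Edge 4 L => if e₁.2 = 1 then
          (if e₁.1 1 = -1 then (-1 : Matrix.unitaryGroup (Fin 3) ℂ) else 1)
        else (fun e₀ : Edge 4 L => if e₀.2 = 0 then
            (if e₀.1 0 = -1 then (-1 : Matrix.unitaryGroup (Fin 3) ℂ) else 1)
          else W (Function.update e₀.1 0 s₀, e₀.2))
          (Function.update e₁.1 1 s₁, e₁.2)) m 1).det‖ ≤
      ‖(wilsonDirac (unitaryFundamentalRep (Fin 3) ℂ)
        (fun e : Edge 4 L => if e.1 e.2 = -1 then (-1 : Matrix.unitaryGroup (Fin 3) ℂ) else 1)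
        m 1).det‖ :=
  staticIterate_root (norm_nonneg _) (staticIterate_axisBound hS 2 _ m hm)
    (fun _ => norm_nonneg _) fun s₂ => staticIterate_level3 hS m hm W s₀ s₁ s₂

/-- Level 1: every field of the form `S⁰_{s₀} W` is dominated by the all-seams trivial field
(axis-`1` bound and level 2). -/
theorem staticIterate_level1 {L : ℕ} [NeZero L]
    (hS : ∀ (V : GaugeConfig 4 L (Matrix.unitaryGroup (Fin 3) ℂ)) (m : ℝ), -1 < m →
      ‖(wilsonDirac (unitaryFundamentalRep (Fin 3) ℂ) V m 1).det‖ ^ L ≤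
        ∏ s : ZMod L, ‖(wilsonDirac (unitaryFundamentalRep (Fin 3) ℂ)
          (fun e : Edge 4 L => if e.2 = 0 then
              (if e.1 0 = -1 then (-1 : Matrix.unitaryGroup (Fin 3) ℂ) else 1)
            else V (Function.update e.1 0 s, e.2)) m 1).det‖)
    (m : ℝ) (hm : -1 < m) (W : GaugeConfig 4 L (Matrix.unitaryGroup (Fin 3) ℂ)) (s₀ : ZMod L) :
    ‖(wilsonDirac (unitaryFundamentalRep (Fin 3) ℂ)
      (fun e₀ : Edge 4 L => if e₀.2 = 0 then
          (if e₀.1 0 = -1 then (-1 : Matrix.unitaryGroup (Fin 3) ℂ) else 1)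
        else W (Function.update e₀.1 0 s₀, e₀.2)) m 1).det‖ ≤
      ‖(wilsonDirac (unitaryFundamentalRep (Fin 3) ℂ)
        (fun e : Edge 4 L => if e.1 e.2 = -1 then (-1 : Matrix.unitaryGroup (Fin 3) ℂ) else 1)
        m 1).det‖ :=
  staticIterate_root (norm_nonneg _) (staticIterate_axisBound hS 1 _ m hm)
    (fun _ => norm_nonneg _) fun s₁ => staticIterate_level2 hS m hm W s₀ s₁

/-! ## The stub -/

/-- **Stub `stub_staticIterate`.** From the time-direction static slice bound for every field
(hypothesis `hS`) and the hypercubic covariance of the Wilson determinant (any `L`): applying the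
bound along the axes `0, 1, 2, 3` in turn makes every link static in every direction, i.e. lands
on the field with all links `1` except `-1` on the four seams `x_μ = -1`; the `L`-th roots are taken
level by level (`staticIterate_root`), so every `U(3)` field is dominated by the all-seams trivial
field: `‖det D_W[V, m]‖ ≤ ‖det D_W[T, m]‖` for `m > -1`. -/
theorem stub_staticIterate {L : ℕ} [NeZero L]
    (hS : ∀ (V : GaugeConfig 4 L (Matrix.unitaryGroup (Fin 3) ℂ)) (m : ℝ), -1 < m →
      ‖(wilsonDirac (unitaryFundamentalRep (Fin 3) ℂ) V m 1).det‖ ^ L ≤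
        ∏ s : ZMod L, ‖(wilsonDirac (unitaryFundamentalRep (Fin 3) ℂ)
          (fun e : Edge 4 L => if e.2 = 0 then (if e.1 0 = -1 then (-1 : Matrix.unitaryGroup (Fin 3) ℂ) else 1)
            else V (Function.update e.1 0 s, e.2)) m 1).det‖)
    (V : GaugeConfig 4 L (Matrix.unitaryGroup (Fin 3) ℂ)) (m : ℝ) (hm : -1 < m) :
    ‖(wilsonDirac (unitaryFundamentalRep (Fin 3) ℂ) V m 1).det‖ ≤
      ‖(wilsonDirac (unitaryFundamentalRep (Fin 3) ℂ)
        (fun e : Edge 4 L => if e.1 e.2 = -1 then (-1 : Matrix.unitaryGroup (Fin 3) ℂ) else 1) m 1).det‖ :=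
  staticIterate_root (norm_nonneg _) (hS V m hm) (fun _ => norm_nonneg _)
    fun s₀ => staticIterate_level1 hS m hm V s₀

end Summit.QuantumFields.QCD.Cruxes.WilsonQuarkStability.FreeTangentLandauChessboard
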